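import Mathlib.Analysis.ODE.Gronwall
import Summits.NavierStokesRegularity.FluidComputer.BlockQuadGate

/-!
# Block design — the LEAKAGE BUDGET of the quadratic exchange gate (design-level, negative)

What a generic Grönwall certificate can and cannot buy.

HONEST FRAMING: low prior, high value-of-information experiment on Tao's machine paradigm; NOT a
claim that NS blows up. Nothing in this file is a statement about Navier–Stokes: it is elementary
real analysis about the quadratic design vector field `quadVF k η (a,b) = (−kηab, ka²)` of
`BlockQuadGate.lean` and the Grönwall bound `gronwallBound 0 L ε τ = ε (e^{Lτ} − 1)/L` of Mathlib,
the quantity through which the LOCAL layer (`Literature/…/FluidComputer/LocalCircuit.lean`: a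
pointwise readout-velocity DEFECT `ε` on a working region `U`, a Lipschitz constant `L` of the
design field on `U`, and the budget axiom `δsh_ge : gronwallBound 0 L ε τc ≤ δsh`) converts
leakage into whole-tick shadowing.

The question. `BlockDegreeNoGo.lean` showed that the LINEAR conservative gate cannot be the local
form of the machine (degree/sign), and `BlockQuadGate.lean` / `BlockQuadClock.lean` rebuilt the
circuit half with the degree-consistent QUADRATIC gate (`quadGate k η`, `k ≥ 6`, rescaled tick
`τc = 1`, tolerance `δsh = 1/50`). Suppose one now tried to discharge the residue through the local
layer, i.e. to certify shadowing from a pointwise defect `ε` by the generic Grönwall budget. How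
small would `ε` have to be?

The answer (kernel-checked here).
* `two_mul_le_of_lipschitzOn` — any Lipschitz constant `L` of `quadVF k η` on a set containing the
  two points `(a ± h, b)` satisfies `2ka ≤ L` (the second component is `ka²`).
* `not_lipschitzOn_quadVF_AinO` — on the OPEN input window `AinO` (no upper amplitude bound) the
  quadratic field admits NO Lipschitz constant at all: the local layer, which needs one on a working
  region containing the admissible inputs, cannot host the quadratic gate on the open window for any
  budget.
* `localBudget_quadVF_tiny` — on the BOUNDED window of `Params.reg` (`aHi = 2`, so `L ≥ 4k ≥ 24`)
  the budget `gronwallBound 0 L ε 1 ≤ 1/50` forces `ε ≤ 2·10⁻¹¹` (via `e^{24} ≥ 2.4·10¹⁰`,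
  `exp_24_ge`, and the monotonicity `exp_sub_one_ge`).

Honest reading (ASSEMBLY §2g.9(k)). (1) This is a statement about a CERTIFICATE, not about the
design or about NS: it says that the only typed route from a pointwise leakage defect to the
whole-tick residue — generic Grönwall — is quantitatively void for the quadratic gate (tolerance
`2·10⁻¹¹` of the rescaled readout velocity, against a leakage defect that is heuristically of order
`k ≥ 6` for a bare two-wavelet pair), while for the linear gate it was cheap (`L = (π/2)/√η ≤ 2.23`,
tolerance about `5·10⁻³` — plain arithmetic, not checked here) but the linear gate is excluded by
degree. (2) It does NOT say the quadratic gate is not shadowable: the field `quadVF` has structure a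
generic Lipschitz bound ignores — the energy radius `R = √(a² + ηb²)` is exactly conserved and
moves only at rate `O(ε)` under a defect, the angle is neutral, and after the crossing the
`a`-direction is damped at rate `kηb ≍ k√ηR` — so an amplitude-uniform, non-exponential
shadowing estimate (`dist ≤ C·ε` over a tick with `C = O(1)`) is plausible; it is a DESIGN-LEVEL
lemma (pure ODE), CONJECTURED, NOT proved here or anywhere in the tree, and it is what a serious
discharge of the residue would need first. (3) Optimising constants (shorter tick with larger `k`,
sharper exponential bounds) moves `2·10⁻¹¹` to roughly `10⁻⁶` by our unchecked estimate
(`Lτc ≳ 12` is forced by the transfer requirement), still three orders of magnitude below the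
linear gate's budget; the dichotomy "degree-consistent ⇒ Grönwall-void, Grönwall-cheap ⇒
degree-inconsistent" is robust.
[cite: Tao2016AveragedNS, §1.3 pp. 10–11]
-/

noncomputable section

open Set Filter Topology NNReal

namespace Summit.NavierStokesRegularity.FluidComputer

open Literature.Analysis.FluidPDE Literature.Analysis.FluidPDE.FluidComputer

namespace BlockDesign

section Lipschitz

/-- The horizontal second difference of the quadratic field: the second component of
`quadVF k η (a+h, b) − quadVF k η (a−h, b)` is `4kah`. [folklore] -/
theorem quadVF_snd_sub (k η a h b : ℝ) :
    (quadVF k η (a + h, b)).2 - (quadVF k η (a - h, b)).2 = 4 * k * a * h := by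
  simp only [quadVF]
  ring

/-- **Lipschitz constants of the quadratic field grow with amplitude.** If `quadVF k η` is
`L`-Lipschitz on a set containing `(a + h, b)` and `(a − h, b)` (`h > 0`), then `2ka ≤ L`.
[folklore] -/
theorem two_mul_le_of_lipschitzOn {k η : ℝ} {L : ℝ≥0} {U : Set (ℝ × ℝ)}
    (hL : LipschitzOnWith L (quadVF k η) U) {a h b : ℝ} (hh : 0 < h)
    (hp : (a + h, b) ∈ U) (hq : (a - h, b) ∈ U) : 2 * k * a ≤ L := by
  have h1 := hL.dist_le_mul _ hp _ hq
  have hd : dist (a + h, b) (a - h, b) = 2 * h := by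
    rw [Prod.dist_eq, Real.dist_eq, Real.dist_eq, sub_self, abs_zero]
    rw [show a + h - (a - h) = 2 * h by ring, abs_of_pos (by linarith)]
    exact max_eq_left (by linarith)
  have h2 : 4 * k * a * h ≤ dist (quadVF k η (a + h, b)) (quadVF k η (a - h, b)) := by
    rw [Prod.dist_eq]
    refine le_trans ?_ (le_max_right _ _)
    rw [Real.dist_eq, quadVF_snd_sub]
    exact le_abs_self _
  rw [hd] at h1
  have h3 : 2 * k * a * (2 * h) ≤ (L : ℝ) * (2 * h) := by linarith
  exact le_of_mul_le_mul_right h3 (by linarith)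

variable {S : CascadeSpecs}

/-- **The open window admits no Lipschitz constant.** For `k > 0` the quadratic field
`quadVF k η` is not Lipschitz on the open input window `AinO P` (which contains `(a, 0)` for every
`a ≥ aLo`): the local layer `LocalCircuit`, whose working region must contain the admissible inputs
and carry a Lipschitz constant of the design field, cannot host the quadratic gate on the open
window, whatever the budget. [folklore] -/
theorem not_lipschitzOn_quadVF_AinO (P : Params S) {k : ℝ} (hk : 0 < k) (L : ℝ≥0) :
    ¬ LipschitzOnWith L (quadVF k S.eta) (AinO P) := by
  intro hL
  have hδ := P.δ_pos
  have h1 : 1 ≤ P.aLo - P.δ := P.one_le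
  have hc := P.c0_nonneg
  have mem : ∀ x : ℝ, P.aLo ≤ x → (x, (0 : ℝ)) ∈ AinO P := fun x hx =>
    ⟨(x, 0), Set.mk_mem_prod (Set.mem_Ici.2 hx) (Set.mem_Icc.2 ⟨by linarith, hc⟩),
      by rw [dist_self]; exact hδ⟩
  set A : ℝ := P.aLo + 1 + (L : ℝ) / (2 * k) with hA
  have hLk : 0 ≤ (L : ℝ) / (2 * k) := div_nonneg L.coe_nonneg (by linarith)
  have hp : (A + 1, (0 : ℝ)) ∈ AinO P := mem _ (by rw [hA]; linarith)
  have hq : (A - 1, (0 : ℝ)) ∈ AinO P := mem _ (by rw [hA]; linarith)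
  have h2 := two_mul_le_of_lipschitzOn hL one_pos hp hq
  have h3 : 2 * k * A = 2 * k * (P.aLo + 1) + L := by
    rw [hA]; field_simp
  rw [h3] at h2
  nlinarith [h2, hk, h1, hδ]

end Lipschitz

section Budget

/-- `e²⁴ ≥ 2.4·10¹⁰ + 1` (from `e ≥ ∑_{i<8} 1/i! ≥ 2.718`). [folklore] -/
theorem exp_24_ge : (24000000001 : ℝ) ≤ Real.exp 24 := by
  have h0 := Real.sum_le_exp_of_nonneg (zero_le_one : (0 : ℝ) ≤ 1) 8
  have h1 : (2.718 : ℝ) ≤ Real.exp 1 := by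
    refine le_trans ?_ h0
    norm_num [Finset.sum_range_succ, Nat.factorial]
  have h2 : (2.718 : ℝ) ^ 24 ≤ Real.exp 1 ^ 24 := pow_le_pow_left₀ (by norm_num) h1 24
  have h3 : Real.exp 1 ^ 24 = Real.exp 24 := by
    rw [← Real.exp_nat_mul]; norm_num
  rw [h3] at h2
  have h4 : (24000000001 : ℝ) ≤ (2.718 : ℝ) ^ 24 := by norm_num
  exact le_trans h4 h2

/-- Monotonicity of the amplification factor: for `L ≥ 24`, `(L/24)(e²⁴ − 1) ≤ e^L − 1`.
[folklore] -/
theorem exp_sub_one_ge {L : ℝ} (hL : 24 ≤ L) :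
    L / 24 * (Real.exp 24 - 1) ≤ Real.exp L - 1 := by
  have hM : 0 < Real.exp 24 := Real.exp_pos _
  have hD : Real.exp L = Real.exp 24 * Real.exp (L - 24) := by
    rw [← Real.exp_add]; ring_nf
  have hlin : 1 + (L - 24) ≤ Real.exp (L - 24) := by
    linarith [Real.add_one_le_exp (L - 24)]
  have h1 : Real.exp 24 * (1 + (L - 24)) ≤ Real.exp 24 * Real.exp (L - 24) :=
    mul_le_mul_of_nonneg_left hlin hM.le
  rw [hD]
  nlinarith [h1, hM, hL, mul_nonneg (sub_nonneg.2 hL) hM.le]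

/-- **The generic budget at `L ≥ 24`.** If `ε ≥ 0` and `gronwallBound 0 L ε 1 ≤ 1/50` with
`L ≥ 24`, then `ε ≤ 2·10⁻¹¹`. [folklore] -/
theorem eps_le_of_gronwallBound {L : ℝ≥0} {ε : ℝ} (hL : 24 ≤ (L : ℝ)) (hε : 0 ≤ ε)
    (h : gronwallBound 0 (L : ℝ) ε 1 ≤ 1 / 50) : ε ≤ 2 / 10 ^ 11 := by
  have hLpos : 0 < (L : ℝ) := by linarith
  rw [gronwallBound_of_K_ne_0 hLpos.ne'] at h
  simp only [mul_one, zero_mul, zero_add] at h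
  have h7 : ε * (Real.exp L - 1) ≤ (L : ℝ) / 50 := by
    have h' := mul_le_mul_of_nonneg_left h hLpos.le
    calc ε * (Real.exp L - 1) = (L : ℝ) * (ε / L * (Real.exp L - 1)) := by
          field_simp
      _ ≤ L * (1 / 50) := h'
      _ = L / 50 := by ring
  have h8 : ε * ((L : ℝ) / 24 * (Real.exp 24 - 1)) ≤ L / 50 :=
    le_trans (mul_le_mul_of_nonneg_left (exp_sub_one_ge hL) hε) h7
  have h9 : ε * (Real.exp 24 - 1) / 24 ≤ 1 / 50 := by
    have h' : (L : ℝ) * (ε * (Real.exp 24 - 1) / 24) ≤ L * (1 / 50) := by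
      calc (L : ℝ) * (ε * (Real.exp 24 - 1) / 24) = ε * ((L : ℝ) / 24 * (Real.exp 24 - 1)) := by
            ring
        _ ≤ L / 50 := h8
        _ = L * (1 / 50) := by ring
    exact le_of_mul_le_mul_left h' hLpos
  have h10 : (24000000000 : ℝ) ≤ Real.exp 24 - 1 := by linarith [exp_24_ge]
  nlinarith [h9, h10, hε, mul_le_mul_of_nonneg_left h10 hε]

variable {S : CascadeSpecs}

/-- **THE LEAKAGE BUDGET OF THE QUADRATIC GATE IS GRÖNWALL-VOID** (design-level, negative). For
`Params.reg` (bounded input window, `aHi = 2`) and every coupling `k ≥ 6`: if a working region `U`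
contains the admissible inputs `Ain`, the quadratic field is `L`-Lipschitz on `U`, and the generic
one-tick budget `gronwallBound 0 L ε 1 ≤ δsh = 1/50` holds, then the admissible pointwise defect is
`ε ≤ 2·10⁻¹¹`. (The points `(2 ± 1/40, 0) ∈ Ain` give `L ≥ 4k ≥ 24`, then
`eps_le_of_gronwallBound`.)
This is the price of degree consistency under a generic certificate; it is not a statement about the
design's shadowability (module docstring (2)) nor about Navier–Stokes. [folklore] -/
theorem localBudget_quadVF_tiny (hS : S.lam0 = 1) (hη : 1 / 2 ≤ S.eta) {k : ℝ} (hk : 6 ≤ k)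
    {U : Set (ℝ × ℝ)} {L : ℝ≥0} {ε : ℝ} (hU : Ain (Params.reg S hS hη) ⊆ U)
    (hL : LipschitzOnWith L (quadVF k S.eta) U) (hε : 0 ≤ ε)
    (hbud : gronwallBound 0 (L : ℝ) ε 1 ≤ 1 / 50) : ε ≤ 2 / 10 ^ 11 := by
  have hin : ∀ x : ℝ, |x - 2| < 1 / 20 → (x, (0 : ℝ)) ∈ Ain (Params.reg S hS hη) := by
    intro x hx
    refine ⟨(2, 0), ?_, ?_⟩
    · simp only [Acore, Params.reg, Set.mem_prod, Set.mem_Icc]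
      norm_num
    · have hδ : (Params.reg S hS hη).δ = 1 / 20 := rfl
      rw [hδ, Prod.dist_eq, Real.dist_eq, dist_self, max_eq_left (abs_nonneg _)]
      exact hx
  have hp : ((2 : ℝ) + 1 / 40, (0 : ℝ)) ∈ U :=
    hU (hin _ (by rw [abs_of_nonneg (by norm_num)]; norm_num))
  have hq : ((2 : ℝ) - 1 / 40, (0 : ℝ)) ∈ U :=
    hU (hin _ (by rw [abs_of_nonpos (by norm_num)]; norm_num))
  have h24 : 2 * k * 2 ≤ (L : ℝ) :=
    two_mul_le_of_lipschitzOn hL (by norm_num : (0 : ℝ) < 1 / 40) hp hq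
  exact eps_le_of_gronwallBound (by linarith) hε hbud

/-- The same conclusion for the tube hypothesis of the local layer as typed (`tube` at `σ = 0` with
`flow_zero`: the closed `δsh`-ball of every admissible input lies in the working region), which
contains `Ain ⊆ U` as the centre points. [folklore] -/
theorem localBudget_quadVF_tiny_of_tube (hS : S.lam0 = 1) (hη : 1 / 2 ≤ S.eta) {k : ℝ}
    (hk : 6 ≤ k) {U : Set (ℝ × ℝ)} {L : ℝ≥0} {ε δsh : ℝ} (hδ : 0 ≤ δsh)
    (htube : ∀ p ∈ Ain (Params.reg S hS hη), Metric.closedBall p δsh ⊆ U)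
    (hL : LipschitzOnWith L (quadVF k S.eta) U) (hε : 0 ≤ ε)
    (hbud : gronwallBound 0 (L : ℝ) ε 1 ≤ 1 / 50) : ε ≤ 2 / 10 ^ 11 :=
  localBudget_quadVF_tiny hS hη hk
    (fun p hp => htube p hp (Metric.mem_closedBall_self hδ)) hL hε hbud

end Budget

end BlockDesign

end Summit.NavierStokesRegularity.FluidComputer
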